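import Mathlib
import Literature.Analysis.Convex.InvariantConvexPrograms
import HarnessLib

/-!
# Symmetry redundancy for convex relaxations (the SU(2) "Ward rows are free" theorem, abstract form)

Cell pub-mbboot (papers/HubbardSuperconductivity/manybody-bootstrap/), open item R-07 §3 of
run/shared/lean/engines/RULINGS.md: for a moment/RDM relaxation whose feasible set `F` and objective `f`
are invariant under a group of symmetries (spin rotations `SU(2)`, lattice point group, …), adding the
"Ward rows" `ℓ(x) = 0` that every symmetric point satisfies — e.g. `ω([S⁻,[S⁺,a]]) = 0` — does NOT change
the optimum of the relaxation, and neither does restricting to symmetric points.  Empirically this was the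
sdp1-g3 dead end (job j071910: bound unchanged in 1D and 2D); here it is a theorem.

Abstract shape.  `X` is the real vector space of moment vectors, `F ⊆ X` the feasible set, `f : X →ₗ[ℝ] ℝ`
the objective, `W ⊆ X` the set cut out by the extra (Ward) constraints.  An *averaging operator* is a
linear `P` that maps `F` into `F`, preserves `f`, and lands in `W`.  Then `f '' (F ∩ W) = f '' F`, hence
equal infima / suprema and the same set of valid dual lower bounds `c ≤ f x ∀ x ∈ F`.

Instance.  For a finite group `G` acting linearly on `X` by `ρ : G →* (X →ₗ[ℝ] X)` with `F` convex and
`ρ g`-invariant and `f` invariant, the group average `(1/|G|) Σ_g ρ g` is an averaging operator whose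
range is the fixed-point set; every functional of the form `L ∘ (ρ g − id)` (a Ward row) vanishes there.
The compact-group (`SU(2)`) version replaces the finite average by the Haar average — same proof modulo
integration — and the finite statement already covers every finite subgroup / lattice point group; the
relaxation-side content (convexity of the PSD+linear feasible set, invariance of the basis) is what sdp1's
engine supplies (R-07: reduction, never Ward rows).

New mathematics of this cell (not a published citation; elementary convex analysis — the nearest published statements are the
symmetry-reduction lemmas for invariant SDPs, e.g. Gatermann–Parrilo, J. Pure Appl. Algebra 192 (2004) §3, which this file does
not cite as a source of the Lean statements): placed under the cell topic `Summits/HubbardSuperconductivity/ManyBodyBootstrap/`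
per the 2026-08-19 LEAN PLACEMENT RULE (written by the cell's typer/referee lineage, gens 103/107, on top of the Literature file
`InvariantConvexPrograms.lean`, p203491; filed by the literature seat). HONEST FRAMING: certified numerical bounds on a lattice
model; not superconductivity, not a phase diagram.
-/

namespace Summit.HubbardSuperconductivity.ManyBodyBootstrap.SymmetryRedundancy

variable {X : Type*} [AddCommGroup X] [Module ℝ X]

/-- An averaging operator for the relaxation `(F, f)` with extra constraint set `W`. -/
structure AveragingData (F W : Set X) (f : X →ₗ[ℝ] ℝ) where
  P : X →ₗ[ℝ] X
  mapsTo : Set.MapsTo P F F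
  obj : ∀ x, f (P x) = f x
  ward : ∀ x, P x ∈ W

namespace AveragingData

variable {F W : Set X} {f : X →ₗ[ℝ] ℝ}

/-- The objective takes the same values on `F ∩ W` as on `F`. -/
theorem image_inter_eq (A : AveragingData F W f) : f '' (F ∩ W) = f '' F := by
  apply Set.Subset.antisymm
  · exact Set.image_mono Set.inter_subset_left
  · rintro _ ⟨x, hx, rfl⟩
    exact ⟨A.P x, ⟨A.mapsTo hx, A.ward x⟩, A.obj x⟩

/-- A dual lower bound is valid on `F` iff it is valid on the Ward-constrained set `F ∩ W`. -/
theorem forall_le_iff (A : AveragingData F W f) (c : ℝ) : (∀ x ∈ F, c ≤ f x) ↔ (∀ x ∈ F ∩ W, c ≤ f x) := by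
  constructor
  · intro h x hx; exact h x hx.1
  · intro h x hx
    have := h (A.P x) ⟨A.mapsTo hx, A.ward x⟩
    rwa [A.obj x] at this

/-- Likewise for upper bounds. -/
theorem forall_ge_iff (A : AveragingData F W f) (c : ℝ) : (∀ x ∈ F, f x ≤ c) ↔ (∀ x ∈ F ∩ W, f x ≤ c) := by
  constructor
  · intro h x hx; exact h x hx.1
  · intro h x hx
    have := h (A.P x) ⟨A.mapsTo hx, A.ward x⟩
    rwa [A.obj x] at this

/-- The optimum (infimum) of the relaxation is unchanged by the Ward rows. -/
theorem sInf_image_inter_eq (A : AveragingData F W f) : sInf (f '' (F ∩ W)) = sInf (f '' F) := by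
  rw [A.image_inter_eq]

/-- The optimum (supremum) of the relaxation is unchanged by the Ward rows. -/
theorem sSup_image_inter_eq (A : AveragingData F W f) : sSup (f '' (F ∩ W)) = sSup (f '' F) := by
  rw [A.image_inter_eq]

/-- Restricting to the range of `P` (the symmetric points) also loses nothing. -/
theorem image_inter_range_eq (A : AveragingData F W f) : f '' (F ∩ Set.range A.P) = f '' F := by
  apply Set.Subset.antisymm
  · exact Set.image_mono Set.inter_subset_left
  · rintro _ ⟨x, hx, rfl⟩
    exact ⟨A.P x, ⟨A.mapsTo hx, x, rfl⟩, A.obj x⟩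

end AveragingData

/-! ### The finite-group average -/

section FiniteGroup

variable {G : Type*} [Group G] [Fintype G] (ρ : G →* (X →ₗ[ℝ] X))

/-- The group average `(1/|G|) Σ_g ρ g`. -/
noncomputable def groupAverage : X →ₗ[ℝ] X :=
  ∑ g : G, ((Fintype.card G : ℝ)⁻¹) • ρ g

/-- Pointwise formula for the group average `(1/|G|) Σ_g ρ g x`. -/
theorem groupAverage_apply (x : X) :
    groupAverage ρ x = ∑ g : G, ((Fintype.card G : ℝ)⁻¹) • ρ g x := by
  simp [groupAverage, LinearMap.sum_apply]

/-- The average of a point of a convex, `G`-invariant set stays in the set. -/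
theorem groupAverage_mem {F : Set X} (hF : Convex ℝ F) (hinv : ∀ g : G, Set.MapsTo (ρ g) F F)
    {x : X} (hx : x ∈ F) : groupAverage ρ x ∈ F := by
  rw [groupAverage_apply]
  have hcard : (Fintype.card G : ℝ) ≠ 0 := by exact_mod_cast Fintype.card_ne_zero
  refine hF.sum_mem (fun g _ => by positivity) ?_ (fun g _ => hinv g hx)
  simp [Finset.sum_const, Finset.card_univ, hcard]

/-- The average is `G`-fixed. -/
theorem apply_groupAverage (g : G) (x : X) : ρ g (groupAverage ρ x) = groupAverage ρ x := by
  simp only [groupAverage_apply, map_sum, map_smul]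
  simp_rw [← Module.End.mul_apply, ← map_mul]
  exact Fintype.sum_equiv (Equiv.mulLeft g) _ _ (fun h => rfl)

/-- A `G`-invariant objective is preserved by the average. -/
theorem apply_groupAverage_of_invariant (f : X →ₗ[ℝ] ℝ) (hf : ∀ (g : G) (x : X), f (ρ g x) = f x)
    (x : X) : f (groupAverage ρ x) = f x := by
  rw [groupAverage_apply, map_sum]
  have hcard : (Fintype.card G : ℝ) ≠ 0 := by exact_mod_cast Fintype.card_ne_zero
  simp_rw [map_smul, hf]
  rw [← Finset.sum_smul]
  simp [Finset.sum_const, Finset.card_univ, hcard]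

/-- The fixed-point set of the action (the "symmetric moment vectors"). -/
def fixedSet : Set X := {x | ∀ g : G, ρ g x = x}

omit [Fintype G] in
/-- A Ward row: any linear functional of the form `L ∘ (ρ g − id)` vanishes on symmetric points. -/
theorem wardRow_eq_zero (L : X →ₗ[ℝ] ℝ) (g : G) {x : X} (hx : x ∈ fixedSet ρ) :
    L (ρ g x - x) = 0 := by
  rw [hx g, sub_self, map_zero]

/-- The finite-group averaging data: convex `G`-invariant feasible set, `G`-invariant objective. -/
noncomputable def groupAveragingData {F : Set X} (hF : Convex ℝ F)
    (hinv : ∀ g : G, Set.MapsTo (ρ g) F F) (f : X →ₗ[ℝ] ℝ)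
    (hf : ∀ (g : G) (x : X), f (ρ g x) = f x) : AveragingData F (fixedSet ρ) f where
  P := groupAverage ρ
  mapsTo := fun _ hx => groupAverage_mem ρ hF hinv hx
  obj := apply_groupAverage_of_invariant ρ f hf
  ward := fun x g => apply_groupAverage ρ g x

/-- **Symmetry redundancy.** For a convex `G`-invariant relaxation with `G`-invariant objective, the
infimum over the feasible set equals the infimum over the symmetric feasible points; in particular any
family of Ward rows (constraints satisfied by every symmetric point) is redundant. -/
theorem sInf_eq_sInf_fixed {F : Set X} (hF : Convex ℝ F) (hinv : ∀ g : G, Set.MapsTo (ρ g) F F)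
    (f : X →ₗ[ℝ] ℝ) (hf : ∀ (g : G) (x : X), f (ρ g x) = f x) :
    sInf (f '' (F ∩ fixedSet ρ)) = sInf (f '' F) :=
  (groupAveragingData ρ hF hinv f hf).sInf_image_inter_eq

/-- Ward rows as an arbitrary constraint set `W ⊇ fixedSet`: still redundant. -/
theorem sInf_eq_sInf_of_fixed_subset {F W : Set X} (hF : Convex ℝ F)
    (hinv : ∀ g : G, Set.MapsTo (ρ g) F F) (f : X →ₗ[ℝ] ℝ)
    (hf : ∀ (g : G) (x : X), f (ρ g x) = f x) (hW : fixedSet ρ ⊆ W) :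
    sInf (f '' (F ∩ W)) = sInf (f '' F) := by
  let A : AveragingData F W f :=
    { P := groupAverage ρ
      mapsTo := fun _ hx => groupAverage_mem ρ hF hinv hx
      obj := apply_groupAverage_of_invariant ρ f hf
      ward := fun x => hW (fun g => apply_groupAverage ρ g x) }
  exact A.sInf_image_inter_eq

/-- Dual form: a lower bound certified against the Ward-augmented relaxation is a lower bound for the
original relaxation (and conversely). -/
theorem forall_le_iff_of_fixed_subset {F W : Set X} (hF : Convex ℝ F)
    (hinv : ∀ g : G, Set.MapsTo (ρ g) F F) (f : X →ₗ[ℝ] ℝ)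
    (hf : ∀ (g : G) (x : X), f (ρ g x) = f x) (hW : fixedSet ρ ⊆ W) (c : ℝ) :
    (∀ x ∈ F, c ≤ f x) ↔ (∀ x ∈ F ∩ W, c ≤ f x) :=
  let A : AveragingData F W f :=
    { P := groupAverage ρ
      mapsTo := fun _ hx => groupAverage_mem ρ hF hinv hx
      obj := apply_groupAverage_of_invariant ρ f hf
      ward := fun x => hW (fun g => apply_groupAverage ρ g x) }
  A.forall_le_iff c

end FiniteGroup

/-! ### The compact-group (Haar) average — the `SU(2)` case

Instantiation of `AveragingData` from the tree's `Literature.Analysis.Convex.haarAverage`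
(p203491, Gatermann–Parrilo 2004 Thm 3.3 / Bachoc–Gijswijt–Schrijver–Vallentin 2012 §3.2): for a compact
group acting by a strongly continuous representation on a Banach space, a closed convex invariant feasible
set and an invariant continuous objective, the Haar average is an averaging operator onto the fixed subspace,
so Ward rows (any `W ⊇ E^G`) are redundant — the compact version promised in the header. -/

section CompactGroup

open MeasureTheory
open Literature.Analysis.Convex Literature.Analysis.Calculus

variable {G : Type*} [Group G] [TopologicalSpace G] [IsTopologicalGroup G] [CompactSpace G]
  [MeasurableSpace G] [BorelSpace G]
variable {E : Type*} [NormedAddCommGroup E] [NormedSpace ℝ E] [CompleteSpace E]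
variable (μ : Measure G) [IsProbabilityMeasure μ] [μ.IsMulLeftInvariant]
variable (ρ : G →* (E →L[ℝ] E)) (hρ : ∀ x, Continuous fun g => ρ g x)
include μ hρ

omit [IsTopologicalGroup G] [μ.IsMulLeftInvariant] [CompleteSpace E] in
/-- Orbit maps of a strongly continuous representation of a compact group are integrable. -/
theorem integrable_orbit_of_continuous (x : E) : Integrable (fun g => ρ g x) μ :=
  (hρ x).integrable_of_hasCompactSupport (HasCompactSupport.of_compactSpace _)

omit [IsTopologicalGroup G] [μ.IsMulLeftInvariant] in
/-- The Haar average as a linear map `E →ₗ[ℝ] E`. -/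
noncomputable def haarAverageLinear : E →ₗ[ℝ] E where
  toFun := haarAverage μ ρ
  map_add' x y := by
    show ∫ g, ρ g (x + y) ∂μ = (∫ g, ρ g x ∂μ) + ∫ g, ρ g y ∂μ
    simp only [map_add]
    exact integral_add (integrable_orbit_of_continuous μ ρ hρ x) (integrable_orbit_of_continuous μ ρ hρ y)
  map_smul' c x := by
    show ∫ g, ρ g (c • x) ∂μ = c • ∫ g, ρ g x ∂μ
    simp only [map_smul]
    exact integral_smul c _

omit [IsTopologicalGroup G] [μ.IsMulLeftInvariant] [CompleteSpace E] in
/-- The bundled Haar average agrees with `haarAverage` pointwise. -/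
@[simp] theorem haarAverageLinear_apply (x : E) : haarAverageLinear μ ρ hρ x = haarAverage μ ρ x := rfl

/-- The compact-group averaging data: closed convex `G`-invariant feasible set, `G`-invariant continuous
objective; `P` = the Haar average, landing in the fixed subspace `E^G`. -/
noncomputable def haarAveragingData {F : Set E} (hFc : Convex ℝ F) (hFcl : IsClosed F)
    (hinv : ∀ g : G, Set.MapsTo (ρ g) F F) (f : E →L[ℝ] ℝ)
    (hf : ∀ (g : G) (v : E), f (ρ g v) = f v) :
    AveragingData F (fixedSubspace ρ : Set E) (f : E →ₗ[ℝ] ℝ) where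
  P := haarAverageLinear μ ρ hρ
  mapsTo := fun x hx => haarAverage_mem μ ρ hFc hFcl hinv (hρ x) hx
  obj := fun x => map_haarAverage μ ρ f hf (hρ x)
  ward := fun x => haarAverage_mem_fixedSubspace μ ρ (hρ x)

/-- **Symmetry redundancy, compact group.** Ward rows `W ⊇ E^G` do not change the optimum. -/
theorem sInf_eq_sInf_of_fixedSubspace_subset {F W : Set E} (hFc : Convex ℝ F) (hFcl : IsClosed F)
    (hinv : ∀ g : G, Set.MapsTo (ρ g) F F) (f : E →L[ℝ] ℝ)
    (hf : ∀ (g : G) (v : E), f (ρ g v) = f v) (hW : (fixedSubspace ρ : Set E) ⊆ W) :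
    sInf (f '' (F ∩ W)) = sInf (f '' F) := by
  let A : AveragingData F W (f : E →ₗ[ℝ] ℝ) :=
    { haarAveragingData μ ρ hρ hFc hFcl hinv f hf with
      ward := fun x => hW (haarAverage_mem_fixedSubspace μ ρ (hρ x)) }
  exact A.sInf_image_inter_eq

/-- Dual form, compact group: a lower bound certified against the Ward-augmented relaxation is a
lower bound for the original relaxation, and conversely. -/
theorem forall_le_iff_of_fixedSubspace_subset {F W : Set E} (hFc : Convex ℝ F) (hFcl : IsClosed F)
    (hinv : ∀ g : G, Set.MapsTo (ρ g) F F) (f : E →L[ℝ] ℝ)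
    (hf : ∀ (g : G) (v : E), f (ρ g v) = f v) (hW : (fixedSubspace ρ : Set E) ⊆ W) (c : ℝ) :
    (∀ x ∈ F, c ≤ f x) ↔ (∀ x ∈ F ∩ W, c ≤ f x) :=
  let A : AveragingData F W (f : E →ₗ[ℝ] ℝ) :=
    { haarAveragingData μ ρ hρ hFc hFcl hinv f hf with
      ward := fun x => hW (haarAverage_mem_fixedSubspace μ ρ (hρ x)) }
  A.forall_le_iff c

end CompactGroup

end Summit.HubbardSuperconductivity.ManyBodyBootstrap.SymmetryRedundancy
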